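import Literature.AlgebraicGeometry.GroupSchemes.KernelCoprimeTorsionRank
import HarnessLib

/-!
# The squeeze: `rk Γ(Ker q) = m·n`, a closed `V_𝔞 ↪ A` of rank `≥ m` inside the `𝔞`-side and a closed `V_𝔟 ↪ A` of rank `≥ n` inside the `𝔟`-side
# force EVERY realisation of the `𝔞`-side to have rank `m` and of the `𝔟`-side rank `n` ([Tate1997FiniteFlatGroupSchemes] §(3.7); [Tate1967] §2.2)

Topic `Literature/AlgebraicGeometry/GroupSchemes`; namespace `Literature.AlgebraicGeometry.GroupSchemes.IdealTorsionCoprimeSplitting` (continues ★ p850362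
`KernelCoprimeTorsionRank` and ★ p849988 `IdealTorsionCoprimeSplittingRank`).  THEOREMS ONLY (no definition, no named fact, no instance, no notation, no
`sorry`).  Cell `hodgecm-mathlib` (D-0151), P6 «MOD programme» (crux hLiu418 = stmt-HodgeConjecture-24832, `--supports`, count-neutral), half-A line L3 (W5
junction `stub_ROOFGEO`, hole (D) `hole_dock`; organ **(SQ) «SQUEEZE»**, LA3-plan (g2) ruling 2026-09-02T08:18:46Z road (T-w); LA3-p03 (g4)).  HONEST LABEL: HC_CM
is proved only modulo the 2 remaining named inputs (hLiu418 24832, h413 24833) until rung 0 closes; this file is generic and discharges none of them.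

THE MATHEMATICS.  `k` a field, `q : A → B` a homomorphism of `k`-group schemes, `ι : O → End A` an action of a commutative ring by endomorphisms (`ι 1 = id`,
`ι(a+b) = ι a · ι b`, `ι(ab) = ι b ≫ ι a`), `βK` the restricted action on `Ker q` (`βK a ≫ ι_{Ker q} = ι_{Ker q} ≫ ι a`), ideals `𝔞 + 𝔟 = (1)` with `𝔞𝔟` killing
the `q`-killed points, `Ker q` affine with `Γ(Ker q)` finite.  A REALISATION of the `𝔞`-side is a monomorphism `ζ : Z ↪ A` whose `T`-points are exactly the points
`x` with `x ≫ ι(a) = 1` (`a ∈ 𝔞`) and `x ≫ q = 1`; likewise for `𝔟`.  (§3) Each side HAS an affine realisation with finite algebra — `Ker (βK e₂) ↪ Ker q ↪ A` for a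
CRT element `e₂ ≡ 1 (𝔟)`, `e₂ ∈ 𝔞` ([Neukirch1999] I (3.6); ★ `comp_crt_eq_one_iff`) —, (§1) any two realisations of one side are isomorphic over `A`, so have the
same rank ([GortzWedhorn2020] Def. 4.45 (2): a closed subscheme is determined by its points functor), hence (§4) `rk Γ(Ker q) = rk Γ(Z_𝔞) · rk Γ(Z_𝔟)` for ANY two
realisations (★ p850362 `finrank_alg_ker_eq_mul` = [Tate1997FiniteFlatGroupSchemes] §(3.7) «the order is multiplicative», `Ker q ≅ Ker q[𝔞] × Ker q[𝔟]`).  (§2) A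
closed immersion `ν : V ↪ A` whose points lie in the `𝔞`-side factors through every realisation `Z_𝔞` by a closed immersion (closed immersions cancel on the left of a
monomorphism, Mathlib `IsClosedImmersion.of_comp`), so `rk Γ(V) ≤ rk Γ(Z_𝔞)` (`Γ(Z_𝔞) ↠ Γ(V)`).  (§5) HEADS: if `rk Γ(Ker q) = m · n` and closed `V_𝔞`, `V_𝔟` inside
the two sides have ranks `≥ m`, `≥ n`, then with `a := rk Γ(Z_𝔞) ≥ m`, `b := rk Γ(Z_𝔟) ≥ n`, `a b = m n > 0` (a group scheme has positive rank: the counit is a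
`k`-point of `Γ`) one gets `a n ≤ a b = m n` so `a ≤ m`, i.e. `a = m`, and symmetrically `b = n` — THE SQUEEZE.  L3 reads it at `x̄` with `q := q̄` (the reduced roof
leg), `𝔞 := 𝔭_{c•w}`, `𝔟 := 𝔭_w`, `m = n = p^f`, `rk Γ(Ker q̄) = p^{2f}` ((K4-fin) ∘ (ρ2‴)), `V_{𝔭_{c•w}} := Ker F|_{G₀(x̄)} ↪ G₀(x̄) ↪ A_x̄` (rank `p^f` by the dock row
`hrkF₀`, `q̄`-killed by (KILL)), `V_{𝔭_w} :=` the flat closure of `K ∩ A_y[𝔭_w]` ((CL-w)); output = the two realisation-free counts (k2b) «`rk Γ(Ker q̄ ∩ A_x̄[𝔭_{c•w}]) =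
p^f`» and (k2b′) «`rk Γ(Ker q̄ ∩ A_x̄[𝔭_w]) = p^f`» [Liu2021, Appendix D, Prop. D.8 (3) p. 137: the two legs of the roof have degree `q`].

* §1 `finrank_alg_eq_of_forall_iff` — two monomorphisms with the same `T`-points have the same `Γ`-rank;
* §2 `finrank_alg_le_of_fac` — `rk Γ(V) ≤ rk Γ(Z)` for a closed `V ↪ M` factoring through a monomorphism `Z ↪ M`, `Z` affine with `Γ(Z)` finite;
* §3 `exists_affine_reading` — the `𝔞`-side has an affine realisation with finite algebra;
* §4 `finrank_alg_ker_eq_mul_of_readings` — `rk Γ(Ker q) = rk Γ(Z_𝔞) · rk Γ(Z_𝔟)` for ANY realisations of the two sides;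
* §5 HEADS **`finrank_alg_eq_of_squeeze`** (every `𝔞`-realisation has rank `m`) and **`finrank_alg_eq_of_squeeze'`** (every `𝔟`-realisation has rank `n`).

## References
* [Tate1997FiniteFlatGroupSchemes] J. Tate, *Finite flat group schemes*, in: Modular Forms and Fermat's Last Theorem (1997) — (1.6)–(1.7) (p. 122), §(3.7) (p. 146).
* [Tate1967] J. T. Tate, *p-divisible groups*, Proc. Conf. Local Fields (Driebergen 1966), Springer 1967 — §2.2.
* [Neukirch1999] J. Neukirch, *Algebraic Number Theory* (1999) — Ch. I §3 (3.6).
* [GortzWedhorn2020] U. Görtz, T. Wedhorn, *Algebraic Geometry I*, 2nd ed. (2020) — Definition 4.45 (2) (p. 117), Section (4.7).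
* [Liu2021] Y. Liu, *Fourier–Jacobi cycles and arithmetic relative trace formula*, Camb. J. Math. 9 (2021) — Appendix D, Prop. D.8 (3) (p. 137).
-/

set_option autoImplicit false

-- Mathlib's `Over`/`Scheme` APIs are stated across semireducible wrappers (as in the ★ `GroupSchemes/*` files).
set_option backward.isDefEq.respectTransparency false

noncomputable section

universe u v

open CategoryTheory CategoryTheory.Limits AlgebraicGeometry MonoidalCategory CartesianMonoidalCategory
open scoped MonObj

namespace Literature.AlgebraicGeometry.GroupSchemes

namespace IdealTorsionCoprimeSplitting

open Literature.AlgebraicGeometry.Motives GroupSchemeKernel AffineGroupScheme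

variable {k : Type u} [Field k]

/-! ## §1 Two realisations of the same points have the same rank -/

/-- **SAME POINTS, SAME RANK**: monomorphisms `ζ₁ : Z₁ ↪ M`, `ζ₂ : Z₂ ↪ M` over `k` through which exactly the same `T`-points of `M` factor are isomorphic over `M`
(★ `exists_iso_of_fac_of_fac`), hence `dim_k Γ(Z₁) = dim_k Γ(Z₂)` (★ `Alg.finrank_eq_of_iso`). [cite: GortzWedhorn2020, Definition 4.45 (2) (p. 117)]
[cite: Tate1997FiniteFlatGroupSchemes, (1.6)–(1.7) (p. 122)] -/
theorem finrank_alg_eq_of_forall_iff {Z₁ Z₂ M : SchemeOver k} (ζ₁ : Z₁ ⟶ M) (ζ₂ : Z₂ ⟶ M) [Mono ζ₁] [Mono ζ₂]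
    (h : ∀ ⦃T : SchemeOver k⦄ (x : T ⟶ M), (∃ z : T ⟶ Z₁, z ≫ ζ₁ = x) ↔ ∃ z : T ⟶ Z₂, z ≫ ζ₂ = x) :
    Module.finrank k (Alg Z₁) = Module.finrank k (Alg Z₂) := by
  obtain ⟨u, hu⟩ := (h ζ₁).1 ⟨𝟙 Z₁, Category.id_comp ζ₁⟩
  obtain ⟨v, hv⟩ := (h ζ₂).2 ⟨𝟙 Z₂, Category.id_comp ζ₂⟩
  obtain ⟨e, -, -⟩ := exists_iso_of_fac_of_fac ζ₁ ζ₂ u hu v hv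
  exact Alg.finrank_eq_of_iso e

/-! ## §2 A closed subscheme factoring through a monomorphism into an affine scheme with finite algebra has smaller rank -/

/-- **LOWER BOUNDS TRANSFER ALONG FACTORISATIONS**: if the closed immersion `ν : V ↪ M` factors as `u ≫ ζ` through a monomorphism `ζ : Z ↪ M` with `Z` affine and
`Γ(Z)` finite over `k`, then `dim_k Γ(V) ≤ dim_k Γ(Z)` — `u` is a closed immersion (closed immersions cancel on the left of the separated `ζ`, Mathlib
`IsClosedImmersion.of_comp`), so `Γ(u) : Γ(Z) ↠ Γ(V)` is surjective (Mathlib `IsClosedImmersion.isAffine_surjective_of_isAffine`).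
[cite: GortzWedhorn2020, Definition 4.45 (2) (p. 117), Section (4.7)] -/
theorem finrank_alg_le_of_fac {V Z M : SchemeOver k} (ν : V ⟶ M) [IsClosedImmersion ν.left] (ζ : Z ⟶ M) [Mono ζ]
    [IsAffine Z.left] [Module.Finite k (Alg Z)] (u : V ⟶ Z) (hu : u ≫ ζ = ν) :
    Module.finrank k (Alg V) ≤ Module.finrank k (Alg Z) := by
  haveI : IsClosedImmersion (u.left ≫ ζ.left) := by rw [← Over.comp_left, hu]; infer_instance
  haveI : IsClosedImmersion u.left := IsClosedImmersion.of_comp u.left ζ.left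
  exact LinearMap.finrank_le_finrank_of_surjective (f := (Alg.comap u).toLinearMap)
    (IsClosedImmersion.isAffine_surjective_of_isAffine u.left).2

/-! ## §3 The canonical affine realisation of «`𝔞`-torsion ∧ `q`-killed» -/

section Kernel

variable {O : Type v} [CommRing O] {A B : SchemeOver k} [GrpObj A] [GrpObj B] (act : O → (A ⟶ A)) (q : A ⟶ B) [IsMonHom q]
  (βK : O → (ker q ⟶ ker q)) [∀ a, IsMonHom (βK a)] (hβK : ∀ a, βK a ≫ kerι q = kerι q ≫ act a)

include hβK in
/-- **THE `𝔞`-SIDE HAS AN AFFINE REALISATION WITH FINITE ALGEBRA**: for `𝔞 + 𝔟 = (1)` with `𝔞𝔟` killing the `q`-killed points and `Ker q` affine with `Γ(Ker q)`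
finite, there is a monomorphism `ζ : Z ↪ A`, `Z` affine with `Γ(Z)` finite over `k`, whose `T`-points are EXACTLY the points `x` with `x ≫ ι(a) = 1` (`a ∈ 𝔞`) and
`x ≫ q = 1`: `Z := Ker (βK e₂) ↪ Ker q ↪ A` for a CRT element `e₂ ≡ 1 (𝔟)`, `e₂ ∈ 𝔞` (★ `exists_crt_of_sup_eq_top`; its points in `Ker q` are the `𝔞`-torsion, ★
`comp_crt_eq_one_iff`; affine and closed in `Ker q`, ★ `isAffine_ker_left` ∕ ★ `isClosedImmersion_kerι_left_of_isAffine`, so `Γ(Ker q) ↠ Γ(Z)`).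
[cite: Neukirch1999, Ch. I §3 (3.6)] [cite: Tate1967, §2.2] [cite: Tate1997FiniteFlatGroupSchemes, (1.6)–(1.7) (p. 122)] [cite: GortzWedhorn2020, Definition 4.45 (2) (p. 117)] -/
theorem exists_affine_reading (hadd : ∀ a b, act (a + b) = act a * act b) (hmul : ∀ a b, act (a * b) = act b ≫ act a)
    {𝔞 𝔟 : Ideal O} (h𝔞𝔟 : 𝔞 ⊔ 𝔟 = ⊤) (hkq : ∀ ⦃T : SchemeOver k⦄ (x : T ⟶ A), x ≫ q = 1 → ∀ c ∈ 𝔞 * 𝔟, x ≫ act c = 1)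
    [IsAffine (ker q).left] [Module.Finite k (Alg (ker q))] :
    ∃ (Z : SchemeOver k) (ζ : Z ⟶ A), Mono ζ ∧ IsAffine Z.left ∧ Module.Finite k (Alg Z) ∧
      ∀ ⦃T : SchemeOver k⦄ (x : T ⟶ A), (∃ z : T ⟶ Z, z ≫ ζ = x) ↔ (∀ a ∈ 𝔞, x ≫ act a = 1) ∧ x ≫ q = 1 := by
  haveI := mono_kerι q
  have hβadd := restrict_add act q βK hβK hadd
  have hβmul := restrict_mul act q βK hβK hmul
  have hk : ∀ c ∈ 𝔞 * 𝔟, βK c = 1 := restrict_eq_one_of_mem_mul act q βK hβK hkq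
  have hk' : ∀ c ∈ 𝔟 * 𝔞, βK c = 1 := fun c hc => hk c (mul_comm 𝔟 𝔞 ▸ hc)
  obtain ⟨e₂, he₂𝔟, he₂𝔞⟩ := exists_crt_of_sup_eq_top ((sup_comm 𝔞 𝔟).symm.trans h𝔞𝔟)
  haveI := mono_kerι (βK e₂)
  haveI : IsAffine (ker (βK e₂)).left := isAffine_ker_left (βK e₂)
  haveI : IsClosedImmersion (kerι (βK e₂)).left := isClosedImmersion_kerι_left_of_isAffine (βK e₂)
  haveI : Module.Finite k (Alg (ker (βK e₂))) :=
    Module.Finite.of_surjective (Alg.comap (kerι (βK e₂))).toLinearMap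
      (IsClosedImmersion.isAffine_surjective_of_isAffine (kerι (βK e₂)).left).2
  -- the points of `Ker (βK e₂)` inside `Ker q`: the `𝔞`-torsion
  have h𝔞 : ∀ ⦃T : SchemeOver k⦄ (x : T ⟶ ker q), (∃ s : T ⟶ ker (βK e₂), s ≫ kerι (βK e₂) = x) ↔ ∀ a ∈ 𝔞, x ≫ βK a = 1 := by
    intro T x
    rw [← comp_crt_eq_one_iff βK hβadd hβmul hk' he₂𝔟 he₂𝔞 x]
    exact ⟨fun ⟨s, hs⟩ => by rw [← hs, Category.assoc, kerι_comp, MonObj.comp_one], fun hx => ⟨kerLift x hx, kerLift_ι x hx⟩⟩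
  refine ⟨ker (βK e₂), kerι (βK e₂) ≫ kerι q, mono_comp _ _, inferInstance, inferInstance, fun T x => ⟨?_, ?_⟩⟩
  · rintro ⟨z, rfl⟩
    refine ⟨fun a ha => ?_, by rw [Category.assoc, Category.assoc, kerι_comp, MonObj.comp_one, MonObj.comp_one]⟩
    have hz : (z ≫ kerι (βK e₂)) ≫ βK a = 1 := (h𝔞 _).1 ⟨z, rfl⟩ a ha
    rw [← Category.assoc, Category.assoc _ (kerι q), ← hβK, ← Category.assoc, hz, MonObj.one_comp]
  · rintro ⟨hxa, hxq⟩
    obtain ⟨s, hs⟩ := (h𝔞 (kerLift x hxq)).2 fun a ha => by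
      rw [← cancel_mono (kerι q), Category.assoc, hβK, kerLift_ι_assoc, MonObj.one_comp]; exact hxa a ha
    exact ⟨s, by rw [← Category.assoc, hs, kerLift_ι]⟩

/-! ## §4 The product law for any two realisations -/

include hβK in
/-- **`rk Γ(Ker q) = rk Γ(Z_𝔞) · rk Γ(Z_𝔟)` FOR ANY TWO REALISATIONS** `ζ_𝔞 : Z_𝔞 ↪ A` of «`𝔞`-torsion ∧ `q`-killed» and `ζ_𝔟 : Z_𝔟 ↪ A` of «`𝔟`-torsion ∧ `q`-killed»
(★ p850362 `finrank_alg_ker_eq_mul` with `m := rk Γ(Z_𝔞)`: every other `𝔞`-realisation has the same points, hence the same rank, §1).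
[cite: Tate1997FiniteFlatGroupSchemes, §(3.7) (p. 146)] [cite: Tate1967, §2.2] [cite: Neukirch1999, Ch. I §3 (3.6)] -/
theorem finrank_alg_ker_eq_mul_of_readings (h1 : act 1 = 𝟙 A) (hadd : ∀ a b, act (a + b) = act a * act b)
    (hmul : ∀ a b, act (a * b) = act b ≫ act a) {𝔞 𝔟 : Ideal O} (h𝔞𝔟 : 𝔞 ⊔ 𝔟 = ⊤)
    (hkq : ∀ ⦃T : SchemeOver k⦄ (x : T ⟶ A), x ≫ q = 1 → ∀ c ∈ 𝔞 * 𝔟, x ≫ act c = 1)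
    [IsAffine (ker q).left] [Module.Finite k (Alg (ker q))]
    {Z𝔞 : SchemeOver k} (ζ𝔞 : Z𝔞 ⟶ A) [Mono ζ𝔞]
    (hZ𝔞 : ∀ ⦃T : SchemeOver k⦄ (x : T ⟶ A), (∃ z : T ⟶ Z𝔞, z ≫ ζ𝔞 = x) ↔ (∀ a ∈ 𝔞, x ≫ act a = 1) ∧ x ≫ q = 1)
    {Z𝔟 : SchemeOver k} (ζ𝔟 : Z𝔟 ⟶ A) [Mono ζ𝔟]
    (hZ𝔟 : ∀ ⦃T : SchemeOver k⦄ (x : T ⟶ A), (∃ z : T ⟶ Z𝔟, z ≫ ζ𝔟 = x) ↔ (∀ b ∈ 𝔟, x ≫ act b = 1) ∧ x ≫ q = 1) :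
    Module.finrank k (Alg (ker q)) = Module.finrank k (Alg Z𝔞) * Module.finrank k (Alg Z𝔟) :=
  finrank_alg_ker_eq_mul act q βK hβK h1 hadd hmul h𝔞𝔟 hkq
    (fun ζ' hζ'm hζ' => by
      haveI := hζ'm
      exact finrank_alg_eq_of_forall_iff ζ' ζ𝔞 fun T x => (hζ' x).trans (hZ𝔞 x).symm)
    ζ𝔟 hZ𝔟

/-! ## §5 HEADS: the squeeze -/

include hβK in
/-- **THE SQUEEZE, `𝔞`-SIDE.**  `q : A → B` a homomorphism of `k`-group schemes with an `O`-action `ι` by homomorphisms (unital, additive, anti-multiplicative), `βK`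
its restriction to `Ker q`, `𝔞 + 𝔟 = (1)` with `𝔞𝔟` killing the `q`-killed points, `Ker q` affine with `Γ(Ker q)` finite of dimension `m · n`.  Suppose given CLOSED
subschemes `ν_𝔞 : V_𝔞 ↪ A`, `ν_𝔟 : V_𝔟 ↪ A` whose points lie in the `𝔞`-side «`x ≫ ι(a) = 1` (`a ∈ 𝔞`) ∧ `x ≫ q = 1`» resp. the `𝔟`-side, with `m ≤ dim_k Γ(V_𝔞)` and
`n ≤ dim_k Γ(V_𝔟)`.  THEN EVERY realisation `ζ : Z ↪ A` of the `𝔞`-side has `dim_k Γ(Z) = m`.  PROOF: affine realisations `R_𝔞`, `R_𝔟` with finite algebras (§3);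
`dim Γ(Ker q) = a · b` with `a := dim Γ(R_𝔞)`, `b := dim Γ(R_𝔟)` (§4); `V_𝔞 ↪ R_𝔞`, `V_𝔟 ↪ R_𝔟` give `m ≤ a`, `n ≤ b` (§2); `a b = m n > 0` (the counit makes `Γ(Ker q)`
a nonzero `k`-space) forces `a = m` (`a n ≤ a b = m n`); `Z ≅ R_𝔞` over `A` (§1). [cite: Tate1997FiniteFlatGroupSchemes, §(3.7) (p. 146)] [cite: Tate1967, §2.2]
[cite: GortzWedhorn2020, Definition 4.45 (2) (p. 117)] [cite: Liu2021, Appendix D, Prop. D.8 (3) (p. 137)] -/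
theorem finrank_alg_eq_of_squeeze (h1 : act 1 = 𝟙 A) (hadd : ∀ a b, act (a + b) = act a * act b)
    (hmul : ∀ a b, act (a * b) = act b ≫ act a) {𝔞 𝔟 : Ideal O} (h𝔞𝔟 : 𝔞 ⊔ 𝔟 = ⊤)
    (hkq : ∀ ⦃T : SchemeOver k⦄ (x : T ⟶ A), x ≫ q = 1 → ∀ c ∈ 𝔞 * 𝔟, x ≫ act c = 1)
    [IsAffine (ker q).left] [Module.Finite k (Alg (ker q))] {m n : ℕ} (hrkK : Module.finrank k (Alg (ker q)) = m * n)
    {V𝔞 : SchemeOver k} (ν𝔞 : V𝔞 ⟶ A) [IsClosedImmersion ν𝔞.left]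
    (hV𝔞 : ∀ ⦃T : SchemeOver k⦄ (x : T ⟶ A), (∃ s : T ⟶ V𝔞, s ≫ ν𝔞 = x) → (∀ a ∈ 𝔞, x ≫ act a = 1) ∧ x ≫ q = 1)
    (hm : m ≤ Module.finrank k (Alg V𝔞))
    {V𝔟 : SchemeOver k} (ν𝔟 : V𝔟 ⟶ A) [IsClosedImmersion ν𝔟.left]
    (hV𝔟 : ∀ ⦃T : SchemeOver k⦄ (x : T ⟶ A), (∃ s : T ⟶ V𝔟, s ≫ ν𝔟 = x) → (∀ b ∈ 𝔟, x ≫ act b = 1) ∧ x ≫ q = 1)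
    (hn : n ≤ Module.finrank k (Alg V𝔟))
    {Z : SchemeOver k} (ζ : Z ⟶ A) [Mono ζ]
    (hZ : ∀ ⦃T : SchemeOver k⦄ (x : T ⟶ A), (∃ z : T ⟶ Z, z ≫ ζ = x) ↔ (∀ a ∈ 𝔞, x ≫ act a = 1) ∧ x ≫ q = 1) :
    Module.finrank k (Alg Z) = m := by
  -- §3: affine realisations of both sides, with finite algebras
  obtain ⟨R𝔞, ρ𝔞, _, _, _, hR𝔞⟩ := exists_affine_reading act q βK hβK hadd hmul h𝔞𝔟 hkq
  have hkq' : ∀ ⦃T : SchemeOver k⦄ (x : T ⟶ A), x ≫ q = 1 → ∀ c ∈ 𝔟 * 𝔞, x ≫ act c = 1 :=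
    fun _ x hx c hc => hkq x hx c (mul_comm 𝔟 𝔞 ▸ hc)
  obtain ⟨R𝔟, ρ𝔟, _, _, _, hR𝔟⟩ := exists_affine_reading act q βK hβK hadd hmul ((sup_comm 𝔟 𝔞).trans h𝔞𝔟) hkq'
  -- §4: `rk Γ(Ker q) = a · b`
  have hprod := finrank_alg_ker_eq_mul_of_readings act q βK hβK h1 hadd hmul h𝔞𝔟 hkq ρ𝔞 hR𝔞 ρ𝔟 hR𝔟
  -- §2: `m ≤ a`, `n ≤ b`
  obtain ⟨u𝔞, hu𝔞⟩ := (hR𝔞 ν𝔞).2 (hV𝔞 ν𝔞 ⟨𝟙 _, Category.id_comp _⟩)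
  obtain ⟨u𝔟, hu𝔟⟩ := (hR𝔟 ν𝔟).2 (hV𝔟 ν𝔟 ⟨𝟙 _, Category.id_comp _⟩)
  have ha : m ≤ Module.finrank k (Alg R𝔞) := hm.trans (finrank_alg_le_of_fac ν𝔞 ρ𝔞 u𝔞 hu𝔞)
  have hb : n ≤ Module.finrank k (Alg R𝔟) := hn.trans (finrank_alg_le_of_fac ν𝔟 ρ𝔟 u𝔟 hu𝔟)
  -- `0 < rk Γ(Ker q)` (the counit is a `k`-point of `Γ(Ker q)`)
  have hpos : 0 < Module.finrank k (Alg (ker q)) :=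
    haveI : Nontrivial (Alg (ker q)) := (Bialgebra.counitAlgHom k (Alg (ker q))).toRingHom.domain_nontrivial
    Module.finrank_pos
  -- the arithmetic squeeze: `a n ≤ a b = m n`, `0 < n` ⟹ `a ≤ m`
  have hn0 : 0 < n := Nat.pos_of_ne_zero fun h0 => by rw [hrkK, h0, mul_zero] at hpos; exact lt_irrefl 0 hpos
  have hle : Module.finrank k (Alg R𝔞) * n ≤ m * n :=
    calc Module.finrank k (Alg R𝔞) * n ≤ Module.finrank k (Alg R𝔞) * Module.finrank k (Alg R𝔟) := Nat.mul_le_mul_left _ hb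
      _ = m * n := hprod.symm.trans hrkK
  -- §1: `Z ≅ R_𝔞`
  rw [finrank_alg_eq_of_forall_iff ζ ρ𝔞 fun T x => (hZ x).trans (hR𝔞 x).symm]
  exact le_antisymm (Nat.le_of_mul_le_mul_right hle hn0) ha

include hβK in
/-- **THE SQUEEZE, `𝔟`-SIDE** (same hypotheses): every realisation `ζ : Z ↪ A` of «`𝔟`-torsion ∧ `q`-killed» has `dim_k Γ(Z) = n` — §5 with the roles of
`(𝔞, m, V_𝔞)` and `(𝔟, n, V_𝔟)` exchanged (`𝔟 + 𝔞 = (1)`, `𝔟𝔞 = 𝔞𝔟`, `n · m = m · n`). [cite: Tate1997FiniteFlatGroupSchemes, §(3.7) (p. 146)] [cite: Tate1967, §2.2]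
[cite: Liu2021, Appendix D, Prop. D.8 (3) (p. 137)] -/
theorem finrank_alg_eq_of_squeeze' (h1 : act 1 = 𝟙 A) (hadd : ∀ a b, act (a + b) = act a * act b)
    (hmul : ∀ a b, act (a * b) = act b ≫ act a) {𝔞 𝔟 : Ideal O} (h𝔞𝔟 : 𝔞 ⊔ 𝔟 = ⊤)
    (hkq : ∀ ⦃T : SchemeOver k⦄ (x : T ⟶ A), x ≫ q = 1 → ∀ c ∈ 𝔞 * 𝔟, x ≫ act c = 1)
    [IsAffine (ker q).left] [Module.Finite k (Alg (ker q))] {m n : ℕ} (hrkK : Module.finrank k (Alg (ker q)) = m * n)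
    {V𝔞 : SchemeOver k} (ν𝔞 : V𝔞 ⟶ A) [IsClosedImmersion ν𝔞.left]
    (hV𝔞 : ∀ ⦃T : SchemeOver k⦄ (x : T ⟶ A), (∃ s : T ⟶ V𝔞, s ≫ ν𝔞 = x) → (∀ a ∈ 𝔞, x ≫ act a = 1) ∧ x ≫ q = 1)
    (hm : m ≤ Module.finrank k (Alg V𝔞))
    {V𝔟 : SchemeOver k} (ν𝔟 : V𝔟 ⟶ A) [IsClosedImmersion ν𝔟.left]
    (hV𝔟 : ∀ ⦃T : SchemeOver k⦄ (x : T ⟶ A), (∃ s : T ⟶ V𝔟, s ≫ ν𝔟 = x) → (∀ b ∈ 𝔟, x ≫ act b = 1) ∧ x ≫ q = 1)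
    (hn : n ≤ Module.finrank k (Alg V𝔟))
    {Z : SchemeOver k} (ζ : Z ⟶ A) [Mono ζ]
    (hZ : ∀ ⦃T : SchemeOver k⦄ (x : T ⟶ A), (∃ z : T ⟶ Z, z ≫ ζ = x) ↔ (∀ b ∈ 𝔟, x ≫ act b = 1) ∧ x ≫ q = 1) :
    Module.finrank k (Alg Z) = n :=
  finrank_alg_eq_of_squeeze act q βK hβK h1 hadd hmul ((sup_comm 𝔟 𝔞).trans h𝔞𝔟)
    (fun _ x hx c hc => hkq x hx c (mul_comm 𝔟 𝔞 ▸ hc)) (m := n) (n := m) (hrkK.trans (mul_comm m n))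
    ν𝔟 hV𝔟 hn ν𝔞 hV𝔞 hm ζ hZ

end Kernel

end IdealTorsionCoprimeSplitting

end Literature.AlgebraicGeometry.GroupSchemes

end
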